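import Mathlib
import HarnessLib
import Summits.ValiantsHypothesis.ValiantsHypothesis.Theorems.LacunarySymmetroidMatrixDescartesOsculationLawGPGenericDet
import Summits.ValiantsHypothesis.ValiantsHypothesis.Theorems.LacunarySymmetroidMatrixDescartesOsculationLawRecursionInvariance

/-!
# ValiantsHypothesis / LacunarySymmetroid — crux `MatrixDescartes` (stmt-ValiantsHypothesis-18050, V1),
# line «osculation-law», `stub_recursion` ROUTE′ density: the two `det ≢ 0` CONDITIONS (D1)₀ / (D1)₁ in the
# DENSITY FRAME's spelling

val-port-3 g1's density frame `GPDensity.mem_closure_nodeFamilyPrime` (bus 2026-08-28 l.≈8239; staged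
`HOME/lmr/staged/port3-OsculationLawGPDensityFrame.lean`) asks each provider, per level `j` (`2 ≤ j`, `h : j+1 ≤ K+1`)
and per condition, for «`∃ B` finite, `∀ ε ∉ B`, `∀ Y` admissible, condition(`S_ε`)» along the segment
`S_ε = (1 − ε)•T + ε•W`.  This file delivers the two determinant conditions of `zmult_node_le'`:

* ★ `det0_cofinite` — (D1)₀, node 1: the pencil of the NEGATED truncated segment letters
  `fun l => −(S_ε (castLE h (castSucc l)))` on the support `fun l => d (castLE h (castSucc l))` has `det ≠ 0` for
  all `ε` off a finite set, PROVIDED it has at the witness (`ε = 1`): `OsculationGeneric.finite_bad_eps_det` after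
  `neg_segment_apply`;
* ★ `det1_cofinite` — (D1)₁, node 2: the pencil of the Gram-node letters
  `fun l => (Y⁻¹)ᵀ * (Fin.snoc (truncated S_ε) (−C•1)) l * Y⁻¹` on `fun l => d (castLE h l)` has `det ≠ 0` for all
  `ε` off a finite (and `Y`-INDEPENDENT) set and every invertible `Y`, PROVIDED the `Y`-free snoc pencil has
  `det ≠ 0` at the witness: `OsculationRecursion.det_pencil_congr` (p4 g13, ✓ `…RecursionInvariance`) strips the
  congruence, `snoc_segment` shows the snoc letters are again a segment (constant last letter), then
  `finite_bad_eps_det`;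
* `finite_bad_eps_det_affine` — the inserted-letter side input `det((1−ε)•B₀ + ε•B₁) ≠ 0` off a finite set
  (for val-lit-p5 g12's `finite_bad_eps_osc_det`);
* `det_pencil_diagonal_letters`, `det_pencil_diagonal_ne_zero_of_eval` — the WITNESS-SIDE discharge of both
  provisos for DIAGONAL letter families (the generic diagonal witness of `…GPWitnessGeneric`, `W_l = −diag(σ_l)`):
  the pencil of diagonal letters is diagonal, its determinant is the product of the diagonal fewnomials, and it is
  nonzero as soon as ONE real point makes every diagonal fewnomial nonzero (`t = 1`: positive sums at node 1,
  negative sums `−Σσ − C` at node 2) — `det0_witness_diagonal`, `det1_witness_diagonal`.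

Honest framing: helper layer (two of the six per-level conditions of an UNREGISTERED density stub of a V1 law
line); `stub_recursion`, the LAW `stub_osculationLaw`, `MatrixDescartes`, Conjecture B and `VP ≠ VNP` are OPEN /
NOT proved.  No definitions, no named facts; Mathlib + the two tree files above.
-/

-- `Summit.ValiantsHypothesis.ValiantsHypothesis.…` is the tree's mandated single-conjunct layout (Sub = Summit).
set_option linter.dupNamespace false

noncomputable section

namespace Summit.ValiantsHypothesis.ValiantsHypothesis.Theorems.LacunarySymmetroidMatrixDescartes

namespace OsculationGeneric

open Polynomial Matrix
open scoped BigOperators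

variable {ι : Type*} [Fintype ι] [DecidableEq ι]

/-! ### Segment algebra -/

omit [Fintype ι] [DecidableEq ι] in
/-- Negating a segment letter gives the segment of the negated letters. [folklore] -/
theorem neg_segment_apply {n : ℕ} (T W : Fin n → Matrix ι ι ℝ) (ε : ℝ) (l : Fin n) :
    -(((1 - ε) • T + ε • W) l) = (1 - ε) • (-T l) + ε • (-W l) := by
  simp only [Pi.add_apply, Pi.smul_apply, smul_neg, neg_add]

omit [Fintype ι] [DecidableEq ι] in
/-- Appending a CONSTANT letter to a segment gives the segment of the appended families. [folklore] -/
theorem snoc_segment {n : ℕ} (T W : Fin n → Matrix ι ι ℝ) (M : Matrix ι ι ℝ) (ε : ℝ) (l : Fin (n + 1)) :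
    (Fin.snoc (fun l => ((1 - ε) • T + ε • W) l) M : Fin (n + 1) → Matrix ι ι ℝ) l =
      (1 - ε) • (Fin.snoc T M : Fin (n + 1) → Matrix ι ι ℝ) l + ε • (Fin.snoc W M : Fin (n + 1) → Matrix ι ι ℝ) l := by
  refine Fin.lastCases ?_ (fun i => ?_) l
  · simp only [Fin.snoc_last]
    rw [← add_smul]; ring_nf; rw [one_smul]
  · simp only [Fin.snoc_castSucc, Pi.add_apply, Pi.smul_apply]

omit [Fintype ι] [DecidableEq ι] in
/-- An affine matrix path `(1−ε)•B₀ + ε•B₁` is `B₀ + ε•(B₁ − B₀)`. [folklore] -/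
theorem affine_path_eq (B₀ B₁ : Matrix ι ι ℝ) (ε : ℝ) : (1 - ε) • B₀ + ε • B₁ = B₀ + ε • (B₁ - B₀) := by
  ext i j
  simp [Matrix.add_apply, Matrix.smul_apply, Matrix.sub_apply]
  ring

/-- **Inserted-letter determinant off a finite set** (the side input of val-lit-p5 g12's `finite_bad_eps_osc_det`):
if `det((1−ε₁)•B₀ + ε₁•B₁) ≠ 0` at ONE parameter then `det((1−ε)•B₀ + ε•B₁) = 0` for only finitely many `ε`.
[folklore] -/
theorem finite_bad_eps_det_affine (B₀ B₁ : Matrix ι ι ℝ) (ε₁ : ℝ) (h : ((1 - ε₁) • B₀ + ε₁ • B₁).det ≠ 0) :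
    {ε : ℝ | ((1 - ε) • B₀ + ε • B₁).det = 0}.Finite := by
  classical
  set p : ℝ[X] := (B₀.map Polynomial.C + (X : ℝ[X]) • (B₁ - B₀).map Polynomial.C).det with hp
  have hkey : ∀ ε : ℝ, ((1 - ε) • B₀ + ε • B₁).det = p.eval ε := by
    intro ε; rw [affine_path_eq, hp, eval_det_affine]
  have hp0 : p ≠ 0 := fun h0 => h (by rw [hkey, h0, eval_zero])
  refine (p.roots.toFinset.finite_toSet).subset fun ε hε => ?_
  rw [Set.mem_setOf_eq, hkey] at hε
  rw [Finset.mem_coe, Multiset.mem_toFinset, mem_roots hp0]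
  exact hε

/-! ### (D1)₀ — node 1 -/

/-- **(D1)₀ off a finite set.**  For letter families `T`, `W` on `Fin (K+1)`, a level `j` with `h : j + 1 ≤ K + 1`,
and the node-1 support/letters of the density frame: if the negated truncated WITNESS letters have a pencil with
`det ≠ 0`, then so do the negated truncated letters of `S_ε = (1−ε)•T + ε•W` for every `ε` off a finite set.
[folklore] -/
theorem det0_cofinite {K : ℕ} (d : Fin (K + 1) → ℕ) (T W : Fin (K + 1) → Matrix ι ι ℝ) {j : ℕ} (h : j + 1 ≤ K + 1)
    (hW : (∑ l, (X : ℝ[X]) ^ (fun l => d (Fin.castLE h (Fin.castSucc l))) l •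
      ((fun l => -(W (Fin.castLE h (Fin.castSucc l)))) l).map Polynomial.C).det ≠ 0) :
    ∃ B : Set ℝ, B.Finite ∧ ∀ ε : ℝ, ε ∉ B →
      (∑ l, (X : ℝ[X]) ^ (fun l => d (Fin.castLE h (Fin.castSucc l))) l •
        ((fun l => -(((1 - ε) • T + ε • W) (Fin.castLE h (Fin.castSucc l)))) l).map Polynomial.C).det ≠ 0 := by
  refine ⟨{ε : ℝ | (∑ l, (X : ℝ[X]) ^ (fun l => d (Fin.castLE h (Fin.castSucc l))) l •
      ((1 - ε) • (-(T (Fin.castLE h (Fin.castSucc l)))) + ε • (-(W (Fin.castLE h (Fin.castSucc l))))).map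
        Polynomial.C).det = 0},
    finite_bad_eps_det (fun l => d (Fin.castLE h (Fin.castSucc l)))
      (fun l => -(T (Fin.castLE h (Fin.castSucc l)))) (fun l => -(W (Fin.castLE h (Fin.castSucc l)))) hW,
    fun ε hε => ?_⟩
  simp only [Set.mem_setOf_eq] at hε
  simp only [neg_segment_apply]
  exact hε

/-! ### (D1)₁ — node 2 (Gram node, congruence stripped) -/

/-- **(D1)₁ off a finite, `Y`-independent set.**  If the `Y`-free snoc pencil of the truncated WITNESS letters with
the constant last letter `−C•1` has `det ≠ 0`, then for every `ε` off a finite set and EVERY invertible `Y` the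
density frame's node-2 pencil (letters `(Y⁻¹)ᵀ * (Fin.snoc (truncated S_ε) (−C•1)) l * Y⁻¹`) has `det ≠ 0`.
[folklore] -/
theorem det1_cofinite {K : ℕ} (d : Fin (K + 1) → ℕ) (T W : Fin (K + 1) → Matrix ι ι ℝ) {j : ℕ} (h : j + 1 ≤ K + 1)
    (C : ℝ)
    (hW : (∑ l, (X : ℝ[X]) ^ (fun l => d (Fin.castLE h l)) l •
      ((Fin.snoc (fun l => W (Fin.castLE h (Fin.castSucc l))) (-(C • (1 : Matrix ι ι ℝ))) :
        Fin (j + 1) → Matrix ι ι ℝ) l).map Polynomial.C).det ≠ 0) :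
    ∃ B : Set ℝ, B.Finite ∧ ∀ ε : ℝ, ε ∉ B → ∀ Y : Matrix ι ι ℝ, Y.det ≠ 0 →
      (∑ l, (X : ℝ[X]) ^ (fun l => d (Fin.castLE h l)) l •
        ((fun l => (Y⁻¹)ᵀ * (Fin.snoc (fun l => ((1 - ε) • T + ε • W) (Fin.castLE h (Fin.castSucc l)))
          (-(C • (1 : Matrix ι ι ℝ))) : Fin (j + 1) → Matrix ι ι ℝ) l * Y⁻¹) l).map Polynomial.C).det ≠ 0 := by
  -- the segment structure of the snoc letters
  set T' : Fin (j + 1) → Matrix ι ι ℝ :=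
    Fin.snoc (fun l => T (Fin.castLE h (Fin.castSucc l))) (-(C • (1 : Matrix ι ι ℝ))) with hT'
  set W' : Fin (j + 1) → Matrix ι ι ℝ :=
    Fin.snoc (fun l => W (Fin.castLE h (Fin.castSucc l))) (-(C • (1 : Matrix ι ι ℝ))) with hW'
  have hseg : ∀ ε : ℝ, (Fin.snoc (fun l => ((1 - ε) • T + ε • W) (Fin.castLE h (Fin.castSucc l)))
      (-(C • (1 : Matrix ι ι ℝ))) : Fin (j + 1) → Matrix ι ι ℝ) = fun l => (1 - ε) • T' l + ε • W' l := by
    intro ε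
    funext l
    refine Fin.lastCases ?_ (fun i => ?_) l
    · simp only [hT', hW', Fin.snoc_last]
      rw [← add_smul]; ring_nf; rw [one_smul]
    · simp only [hT', hW', Fin.snoc_castSucc, Pi.add_apply, Pi.smul_apply]
  refine ⟨{ε : ℝ | (∑ l, (X : ℝ[X]) ^ (fun l => d (Fin.castLE h l)) l •
      ((1 - ε) • T' l + ε • W' l).map Polynomial.C).det = 0},
    finite_bad_eps_det (fun l => d (Fin.castLE h l)) T' W' (by rw [hW']; exact hW), fun ε hε Y hY => ?_⟩
  simp only [Set.mem_setOf_eq] at hε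
  rw [hseg ε]
  -- strip the congruence by `Y⁻¹`
  have hcongr := OsculationRecursion.det_pencil_congr (Y⁻¹) (fun l => d (Fin.castLE h l))
    (fun l => (1 - ε) • T' l + ε • W' l)
  simp only at hcongr ⊢
  rw [hcongr]
  refine mul_ne_zero ?_ hε
  rw [Ne, Polynomial.C_eq_zero]
  have hYinv : (Y⁻¹).det ≠ 0 := by
    rw [Matrix.det_nonsing_inv, Ring.inverse_eq_inv']
    exact inv_ne_zero hY
  exact pow_ne_zero 2 hYinv

/-! ### Witness-side discharge for DIAGONAL letter families -/

omit [Fintype ι] in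
/-- The pencil of diagonal letters is the diagonal matrix of the diagonal fewnomials. [folklore] -/
theorem pencil_diagonal_letters {n : ℕ} (e : Fin n → ℕ) (δ : Fin n → ι → ℝ) :
    (∑ l, (X : ℝ[X]) ^ e l • (Matrix.diagonal (δ l)).map Polynomial.C) =
      Matrix.diagonal fun i => ∑ l, Polynomial.C (δ l i) * (X : ℝ[X]) ^ e l := by
  refine Matrix.ext fun i j => ?_
  simp only [Matrix.sum_apply, Matrix.smul_apply, Matrix.map_apply, Matrix.diagonal_apply, smul_eq_mul]
  split_ifs with hij
  · exact Finset.sum_congr rfl fun l _ => mul_comm _ _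
  · simp

/-- The determinant of a pencil of diagonal letters is the product of the diagonal fewnomials. [folklore] -/
theorem det_pencil_diagonal_letters {n : ℕ} (e : Fin n → ℕ) (δ : Fin n → ι → ℝ) :
    (∑ l, (X : ℝ[X]) ^ e l • (Matrix.diagonal (δ l)).map Polynomial.C).det =
      ∏ i, ∑ l, Polynomial.C (δ l i) * (X : ℝ[X]) ^ e l := by
  rw [pencil_diagonal_letters, Matrix.det_diagonal]

/-- A pencil of diagonal letters has `det ≠ 0` as soon as ONE real point makes every diagonal fewnomial nonzero.
[folklore] -/
theorem det_pencil_diagonal_ne_zero_of_eval {n : ℕ} (e : Fin n → ℕ) (δ : Fin n → ι → ℝ) (t : ℝ)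
    (ht : ∀ i, ∑ l, δ l i * t ^ e l ≠ 0) :
    (∑ l, (X : ℝ[X]) ^ e l • (Matrix.diagonal (δ l)).map Polynomial.C).det ≠ 0 := by
  rw [det_pencil_diagonal_letters]
  refine Finset.prod_ne_zero_iff.2 fun i _ h0 => ht i ?_
  have := congr_arg (Polynomial.eval t) h0
  simpa [eval_finsetSum] using this

/-- **(D1)₀ proviso at a diagonal witness**: for `W_l = −diag(σ_l)` with POSITIVE entries the negated truncated
letters are `diag(σ_l)`, and their pencil has `det ≠ 0` (every diagonal fewnomial is positive at `t = 1`).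
[folklore] -/
theorem det0_witness_diagonal {K : ℕ} (d : Fin (K + 1) → ℕ) (σ : Fin (K + 1) → ι → ℝ) (hσ : ∀ l i, 0 < σ l i)
    {j : ℕ} (h : j + 1 ≤ K + 1) (hj : 1 ≤ j) :
    (∑ l, (X : ℝ[X]) ^ (fun l => d (Fin.castLE h (Fin.castSucc l))) l •
      ((fun l => -((fun l => -Matrix.diagonal (σ l)) (Fin.castLE h (Fin.castSucc l)))) l).map Polynomial.C).det ≠ 0 := by
  simp only [neg_neg]
  refine det_pencil_diagonal_ne_zero_of_eval _ (fun l => σ (Fin.castLE h (Fin.castSucc l))) 1 fun i => ?_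
  simp only [one_pow, mul_one]
  have : 0 < ∑ l : Fin j, σ (Fin.castLE h (Fin.castSucc l)) i :=
    Finset.sum_pos (fun l _ => hσ _ _) ⟨⟨0, by omega⟩, Finset.mem_univ _⟩
  exact this.ne'

/-- **(D1)₁ proviso at a diagonal witness**: the `Y`-free snoc pencil of the truncated letters `−diag(σ_l)` with last
letter `−C•1` (`C > 0`, entries positive) has `det ≠ 0` (every diagonal fewnomial is negative at `t = 1`).
[folklore] -/
theorem det1_witness_diagonal {K : ℕ} (d : Fin (K + 1) → ℕ) (σ : Fin (K + 1) → ι → ℝ) (hσ : ∀ l i, 0 < σ l i)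
    {j : ℕ} (h : j + 1 ≤ K + 1) (C : ℝ) (hC : 0 < C) :
    (∑ l, (X : ℝ[X]) ^ (fun l => d (Fin.castLE h l)) l •
      ((Fin.snoc (fun l => (fun l => -Matrix.diagonal (σ l)) (Fin.castLE h (Fin.castSucc l)))
        (-(C • (1 : Matrix ι ι ℝ))) : Fin (j + 1) → Matrix ι ι ℝ) l).map Polynomial.C).det ≠ 0 := by
  -- every letter is diagonal: `−diag(σ) = diag(−σ)`, `−C•1 = diag(−C)`
  have hletters : (Fin.snoc (fun l => (fun l => -Matrix.diagonal (σ l)) (Fin.castLE h (Fin.castSucc l)))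
      (-(C • (1 : Matrix ι ι ℝ))) : Fin (j + 1) → Matrix ι ι ℝ) =
      fun l => Matrix.diagonal ((Fin.snoc (fun l => fun i => -σ (Fin.castLE h (Fin.castSucc l)) i)
        (fun _ => -C) : Fin (j + 1) → ι → ℝ) l) := by
    funext l
    refine Fin.lastCases ?_ (fun i => ?_) l
    · simp only [Fin.snoc_last]
      ext a b
      simp [Matrix.diagonal_apply, Matrix.one_apply]
      split_ifs <;> simp
    · simp only [Fin.snoc_castSucc]
      ext a b
      simp [Matrix.diagonal_apply]
      split_ifs <;> simp
  rw [hletters]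
  refine det_pencil_diagonal_ne_zero_of_eval _ _ 1 fun i => ?_
  simp only [one_pow, mul_one]
  rw [Fin.sum_univ_castSucc]
  simp only [Fin.snoc_castSucc, Fin.snoc_last]
  have : ∑ l : Fin j, -σ (Fin.castLE h (Fin.castSucc l)) i ≤ 0 :=
    Finset.sum_nonpos fun l _ => (neg_neg_iff_pos.2 (hσ _ _)).le
  linarith

end OsculationGeneric

end Summit.ValiantsHypothesis.ValiantsHypothesis.Theorems.LacunarySymmetroidMatrixDescartes
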